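import Summits.BirchSwinnertonDyer.BirchSwinnertonDyer.Theorems.Rank2Observatory2DescKillSig3
import HarnessLib

/-!
# BirchSwinnertonDyer — SEL2CUBIC kill layer: the certificates `killCheck` and `sig3Check` in RESIDUE form
# («no `p`-primitive integer vector with `p^N ∣ killQ`»), the form a `2`-Selmer class contradicts

HONEST FRAMING: route `ShaPrimaryTransfer`, seat `bsd-line-spt-p1` (g30), `--supports` item T =
`FiniteShaComponentTransfer` (stmt-22356), UNCHANGED (conjecture-grade at corank ≥ 2). BSD in rank ≥ 2 is NOT
proved by any of this. THEOREMS ONLY.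

The landed kill certificates conclude `TwoDescKill.KillValidAt` — «the quadric pair `killQ` of the class has no
INTEGER zero primitive at `p`» — from an EXACT integer zero (`killCheck_sound`, `sig3Check_sound`). For
`2`-Selmer classes (whose `2`-coverings have `ℚ_p`-points but in general no rational point) the relevant
statement is the residue one that the certificates actually verify: no integer vector primitive at `p` has BOTH
quadrics divisible by the certificate's modulus. This file re-reads the two landed soundness proofs with that
weaker hypothesis — the proofs are the tree's, verbatim, except at the single place where the exact zero was used
(reduction of `killQ v` modulo the working modulus):

* `killCheck_sound_mod` — `killCheck p … fuel = true` ⟹ no `p`-primitive `v` with `p^{fuel+1} ∣ Q₁(v), Q₂(v)`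
  (adapted from `Rank2Observatory2DescKillCheck.killCheck_sound`);
* `root_rel_mod`, `sig3Check_sound_mod` — `sig3Check q … N ε₁ ε₂ ε₃ = true` ⟹ no `q`-primitive `v` with
  `q^N ∣ Q₁(v), Q₂(v)` (adapted from `Rank2Observatory2DescKillSig3Core.root_rel`,
  `Rank2Observatory2DescKillSig3.sig3Check_sound`).

Together with `…SelmerCubicKillLocal.exists_primitive_killQ_dvd_of_forall_extension` (a `2`-Selmer class
supplies such a `v` for EVERY `N`) these make the `killCheck` / `sig3` kills of the census Selmer-sound, pending
the local Cassels uniformity step. [cite: Cassels1991LecturesEllipticCurves, §15] [cite: CremonaAlgorithms1997, §3.6]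
-/

-- single-conjunct summit: `Summit.BirchSwinnertonDyer.BirchSwinnertonDyer.…` repeats the name by design
set_option linter.dupNamespace false

namespace Summit.BirchSwinnertonDyer.BirchSwinnertonDyer.Theorems.ShaPrimaryTransferSelmerCubicKill

open Summit.BirchSwinnertonDyer.BirchSwinnertonDyer.Rank2Observatory
open Summit.BirchSwinnertonDyer.BirchSwinnertonDyer.Rank2Observatory.TwoDescKill

/-! ## The residue-tree certificate `killCheck` -/

/-- **Soundness of the kill certificate, residue form**: if `killCheck p … fuel = true` for a prime `p`, then
no integer vector primitive at `p` has `p^{fuel+1} ∣ Q₁` and `p^{fuel+1} ∣ Q₂` (the tree's `killCheck_sound`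
verbatim — chart normalisation by a unit mod `N = p^{fuel+1}`, then `check_sound` — with the exact zero
replaced by the congruence it was only ever used for). [cite: CremonaAlgorithms1997, §3.6] -/
theorem killCheck_sound_mod {p : ℕ} (hp : p.Prime) {a b c : ℤ} {z : ℤ × ℤ × ℤ} {t₁ t₂ : ℤ} {fuel : ℕ}
    (h : killCheck p a b c z t₁ t₂ fuel = true) (v : ℤ × ℤ × ℤ × ℤ)
    (hprim : ¬ ((p : ℤ) ∣ v.1 ∧ (p : ℤ) ∣ v.2.1 ∧ (p : ℤ) ∣ v.2.2.1 ∧ (p : ℤ) ∣ v.2.2.2))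
    (h0 : (p : ℤ) ^ (fuel + 1) ∣ (killQ a b c z t₁ t₂ v).1 ∧ (p : ℤ) ^ (fuel + 1) ∣ (killQ a b c z t₁ t₂ v).2) :
    False := by
  have hp0 : 0 < p := hp.pos
  have hpZ : Prime (p : ℤ) := Nat.prime_iff_prime_int.mp hp
  simp only [killCheck, Bool.and_eq_true, List.all_eq_true, List.mem_range] at h
  obtain ⟨⟨⟨hc0, hc1⟩, hc2⟩, hc3⟩ := h
  -- the modulus of the leaves and a unit normalising a coordinate prime to `p`
  set N : ℕ := p * p ^ fuel with hN
  have unit_of : ∀ w : ℤ, ¬ (p : ℤ) ∣ w → ∃ l m : ℤ, l * w + m * (N : ℤ) = 1 := by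
    intro w hw
    have hcop : IsCoprime w ((p : ℤ) ^ (fuel + 1)) :=
      ((Prime.coprime_iff_not_dvd hpZ).mpr hw).symm.pow_right
    obtain ⟨l, m, hlm⟩ := hcop
    exact ⟨l, m, by rw [hN]; push_cast; linear_combination hlm⟩
  -- residues mod p as digits
  have digit : ∀ w : ℤ, ∃ d : ℕ, d < p ∧ (p : ℤ) ∣ w - d := by
    intro w
    have hp' : (0 : ℤ) < p := by exact_mod_cast hp0
    refine ⟨(w % (p : ℤ)).toNat, ?_, w / p, ?_⟩
    · have := Int.emod_lt_of_pos w hp'; have := Int.emod_nonneg w hp'.ne'; omega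
    · rw [Int.toNat_of_nonneg (Int.emod_nonneg w hp'.ne')]
      linear_combination (-1 : ℤ) * Int.emod_add_ediv_mul w (p : ℤ)
  -- the scaled vector `u = l • v` with the chart coordinate replaced by `1` is a zero mod `N`
  have scaled : ∀ (l m w : ℤ), l * w + m * (N : ℤ) = 1 → ∀ u : ℤ × ℤ × ℤ × ℤ,
      (N : ℤ) ∣ u.1 - l * v.1 → (N : ℤ) ∣ u.2.1 - l * v.2.1 → (N : ℤ) ∣ u.2.2.1 - l * v.2.2.1 →
      (N : ℤ) ∣ u.2.2.2 - l * v.2.2.2 →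
      ((p * p ^ fuel : ℕ) : ℤ) ∣ (killQ a b c z t₁ t₂ u).1 ∧
        ((p * p ^ fuel : ℕ) : ℤ) ∣ (killQ a b c z t₁ t₂ u).2 := by
    intro l m w _ u g₀ g₁ g₂ g₃
    have hc := killQ_congr a b c z t₁ t₂ N (v := (l * v.1, l * v.2.1, l * v.2.2.1, l * v.2.2.2))
      g₀ g₁ g₂ g₃
    rw [killQ_smul] at hc
    have hNp : (N : ℤ) = (p : ℤ) ^ (fuel + 1) := by rw [hN]; push_cast; ring
    have hB1 : (N : ℤ) ∣ l ^ 2 * (killQ a b c z t₁ t₂ v).1 := hNp ▸ dvd_mul_of_dvd_right h0.1 _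
    have hB2 : (N : ℤ) ∣ l ^ 2 * (killQ a b c z t₁ t₂ v).2 := hNp ▸ dvd_mul_of_dvd_right h0.2 _
    have hA1 := dvd_add hc.1 hB1
    have hA2 := dvd_add hc.2 hB2
    rw [sub_add_cancel] at hA1 hA2
    rw [hN] at hA1 hA2
    exact ⟨hA1, hA2⟩
  by_cases hv0 : (p : ℤ) ∣ v.1
  · by_cases hv1 : (p : ℤ) ∣ v.2.1
    · by_cases hv2 : (p : ℤ) ∣ v.2.2.1
      · -- chart 3
        have hv3 : ¬ (p : ℤ) ∣ v.2.2.2 := fun h3 => hprim ⟨hv0, hv1, hv2, h3⟩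
        obtain ⟨l, m, hlm⟩ := unit_of _ hv3
        have hz := scaled l m _ hlm (l * v.1, l * v.2.1, l * v.2.2.1, 1) (by simp) (by simp) (by simp)
          ⟨m, by linear_combination -hlm⟩
        refine check_sound hp0 a b c z t₁ t₂ fuel (0, 0, 0, 1) 3 p hc3 (l * v.1, l * v.2.1, l * v.2.2.1, 1)
          rfl ?_ ?_ ?_ (by simp) hz
        · simpa using (dvd_mul_of_dvd_right hv0 l)
        · simpa using (dvd_mul_of_dvd_right hv1 l)
        · simpa using (dvd_mul_of_dvd_right hv2 l)
      · -- chart 2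
        obtain ⟨l, m, hlm⟩ := unit_of _ hv2
        obtain ⟨d₂, hd₂, e₂⟩ := digit (l * v.2.2.2)
        have hz := scaled l m _ hlm (l * v.1, l * v.2.1, 1, l * v.2.2.2) (by simp) (by simp)
          ⟨m, by linear_combination -hlm⟩ (by simp)
        refine check_sound hp0 a b c z t₁ t₂ fuel (0, 0, 1, (d₂ : ℤ)) 2 p (hc2 d₂ hd₂)
          (l * v.1, l * v.2.1, 1, l * v.2.2.2) rfl ?_ ?_ (by simp) (by simpa using e₂) hz
        · simpa using (dvd_mul_of_dvd_right hv0 l)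
        · simpa using (dvd_mul_of_dvd_right hv1 l)
    · -- chart 1
      obtain ⟨l, m, hlm⟩ := unit_of _ hv1
      obtain ⟨d₁, hd₁, e₁⟩ := digit (l * v.2.2.1)
      obtain ⟨d₂, hd₂, e₂⟩ := digit (l * v.2.2.2)
      have hz := scaled l m _ hlm (l * v.1, 1, l * v.2.2.1, l * v.2.2.2) (by simp)
        ⟨m, by linear_combination -hlm⟩ (by simp) (by simp)
      refine check_sound hp0 a b c z t₁ t₂ fuel (0, 1, (d₁ : ℤ), (d₂ : ℤ)) 1 p (hc1 d₁ hd₁ d₂ hd₂)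
        (l * v.1, 1, l * v.2.2.1, l * v.2.2.2) rfl ?_ (by simp) (by simpa using e₁) (by simpa using e₂) hz
      simpa using (dvd_mul_of_dvd_right hv0 l)
  · -- chart 0
    obtain ⟨l, m, hlm⟩ := unit_of _ hv0
    obtain ⟨d₀, hd₀, e₀⟩ := digit (l * v.2.1)
    obtain ⟨d₁, hd₁, e₁⟩ := digit (l * v.2.2.1)
    obtain ⟨d₂, hd₂, e₂⟩ := digit (l * v.2.2.2)
    have hz := scaled l m _ hlm (1, l * v.2.1, l * v.2.2.1, l * v.2.2.2)
      ⟨m, by linear_combination -hlm⟩ (by simp) (by simp) (by simp)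
    exact check_sound hp0 a b c z t₁ t₂ fuel (1, (d₀ : ℤ), (d₁ : ℤ), (d₂ : ℤ)) 0 p
      (hc0 d₀ hd₀ d₁ hd₁ d₂ hd₂) (1, l * v.2.1, l * v.2.2.1, l * v.2.2.2) rfl (by simp)
      (by simpa using e₀) (by simpa using e₁) (by simpa using e₂) hz

/-! ## The signature certificate `sig3Check` -/

/-- **Evaluation at a root mod `q^N`, residue form**: as `root_rel`, assuming only
`q^N ∣ Q₁(r₀, r₁, r₂, n)` and `q^N ∣ Q₂(r₀, r₁, r₂, n)` (the coordinates of `z·r² + n²T − w₀` vanish in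
`ℤ/q^N`, which is all the evaluation `α ↦ ε` uses). [cite: Cassels1991LecturesEllipticCurves, §15] -/
theorem root_rel_mod {q N : ℕ} {a b c : ℤ} {z : ℤ × ℤ × ℤ} {t₁ t₂ ε : ℤ}
    (hg : (ε ^ 3 + a * ε ^ 2 + b * ε + c) % ((q ^ N : ℕ) : ℤ) = 0) {r₀ r₁ r₂ n : ℤ}
    (h0 : (q : ℤ) ^ N ∣ (killQ a b c z t₁ t₂ (r₀, r₁, r₂, n)).1 ∧
      (q : ℤ) ^ N ∣ (killQ a b c z t₁ t₂ (r₀, r₁, r₂, n)).2) :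
    (q : ℤ) ^ N ∣ ((z.1 + z.2.1 * ε + z.2.2 * ε ^ 2) % ((q ^ N : ℕ) : ℤ)) * (r₀ + r₁ * ε + r₂ * ε ^ 2) ^ 2 -
      ((zsq a b c z (r₀, r₁, r₂)).1 - n ^ 2 * ((t₁ * ε + t₂ * ε ^ 2) % ((q ^ N : ℕ) : ℤ))) := by
  set M : ℕ := q ^ N with hM
  have hMZ : ((M : ℕ) : ℤ) = (q : ℤ) ^ N := by rw [hM, Nat.cast_pow]
  -- the root in `ZMod M`
  have hα : (ε : ZMod M) ^ 3 + (a : ZMod M) * (ε : ZMod M) ^ 2 + (b : ZMod M) * (ε : ZMod M) + (c : ZMod M) = 0 := by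
    have := (ZMod.intCast_zmod_eq_zero_iff_dvd _ M).mpr (Int.dvd_of_emod_eq_zero hg)
    push_cast at this
    exact this
  -- the two coordinates of `z·r² + n²T`
  have hQ1 : ((M : ℕ) : ℤ) ∣ (zsq a b c z (r₀, r₁, r₂)).2.1 + t₁ * n ^ 2 := by
    have := h0.1; simpa only [killQ, hMZ] using this
  have hQ2 : ((M : ℕ) : ℤ) ∣ (zsq a b c z (r₀, r₁, r₂)).2.2 + t₂ * n ^ 2 := by
    have := h0.2; simpa only [killQ, hMZ] using this
  have hQ1' : ((zsq a b c z (r₀, r₁, r₂)).2.1 : ZMod M) + (t₁ : ZMod M) * (n : ZMod M) ^ 2 = 0 := by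
    have := (ZMod.intCast_zmod_eq_zero_iff_dvd _ M).mpr hQ1
    push_cast at this
    exact this
  have hQ2' : ((zsq a b c z (r₀, r₁, r₂)).2.2 : ZMod M) + (t₂ : ZMod M) * (n : ZMod M) ^ 2 = 0 := by
    have := (ZMod.intCast_zmod_eq_zero_iff_dvd _ M).mpr hQ2
    push_cast at this
    exact this
  -- `ev_ε (z·r²) = ev_ε z · (ev_ε r)²` in `ZMod M`
  have hmap := map_zsq (Int.castRingHom (ZMod M)) a b c z (r₀, r₁, r₂)
  simp only [eq_intCast] at hmap
  have hev := ev_zsq hα ((z.1 : ZMod M), (z.2.1 : ZMod M), (z.2.2 : ZMod M))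
    ((r₀ : ZMod M), (r₁ : ZMod M), (r₂ : ZMod M))
  rw [← hmap] at hev
  simp only [ev] at hev
  -- the relation with exact `Z(ε)`, `T(ε)`
  have hd : ((M : ℕ) : ℤ) ∣ (z.1 + z.2.1 * ε + z.2.2 * ε ^ 2) * (r₀ + r₁ * ε + r₂ * ε ^ 2) ^ 2 -
      ((zsq a b c z (r₀, r₁, r₂)).1 - n ^ 2 * (t₁ * ε + t₂ * ε ^ 2)) := by
    apply (ZMod.intCast_zmod_eq_zero_iff_dvd _ M).mp
    push_cast
    linear_combination (-1 : ZMod M) * hev + (ε : ZMod M) * hQ1' + (ε : ZMod M) ^ 2 * hQ2'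
  -- reduce `Z`, `T` mod `M`
  rw [hMZ] at hd ⊢
  obtain ⟨k, hk⟩ := hd
  have e1 := Int.emod_add_ediv_mul (z.1 + z.2.1 * ε + z.2.2 * ε ^ 2) ((q : ℤ) ^ N)
  have e2 := Int.emod_add_ediv_mul (t₁ * ε + t₂ * ε ^ 2) ((q : ℤ) ^ N)
  exact ⟨k - (z.1 + z.2.1 * ε + z.2.2 * ε ^ 2) / (q : ℤ) ^ N * (r₀ + r₁ * ε + r₂ * ε ^ 2) ^ 2 -
      n ^ 2 * ((t₁ * ε + t₂ * ε ^ 2) / (q : ℤ) ^ N), by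
    linear_combination hk + (r₀ + r₁ * ε + r₂ * ε ^ 2) ^ 2 * e1 + n ^ 2 * e2⟩

/-- **Soundness of the signature kill certificate, residue form**: if `sig3Check q … N ε₁ ε₂ ε₃ = true` for a
prime `q`, then no integer vector primitive at `q` has `q^N ∣ Q₁` and `q^N ∣ Q₂` (the tree's `sig3Check_sound`
verbatim with `root_rel_mod` for `root_rel`). [cite: Cassels1991LecturesEllipticCurves, §15]
[cite: CremonaAlgorithms1997, §3.6] -/
theorem sig3Check_sound_mod {q : ℕ} (hq : q.Prime) {a b c : ℤ} {z : ℤ × ℤ × ℤ} {t₁ t₂ : ℤ} {N : ℕ}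
    {ε₁ ε₂ ε₃ : ℤ} (h : sig3Check q a b c z t₁ t₂ N ε₁ ε₂ ε₃ = true) (v : ℤ × ℤ × ℤ × ℤ)
    (hprim : ¬ ((q : ℤ) ∣ v.1 ∧ (q : ℤ) ∣ v.2.1 ∧ (q : ℤ) ∣ v.2.2.1 ∧ (q : ℤ) ∣ v.2.2.2))
    (h0 : (q : ℤ) ^ N ∣ (killQ a b c z t₁ t₂ v).1 ∧ (q : ℤ) ^ N ∣ (killQ a b c z t₁ t₂ v).2) :
    False := by
  obtain ⟨r₀, r₁, r₂, n⟩ := v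
  have hq0 : 0 < q := hq.pos
  simp only [sig3Check, Bool.and_eq_true] at h
  obtain ⟨⟨⟨⟨⟨⟨⟨hk₁, hk₂⟩, hk₃⟩, hu₁₂⟩, hu₁₃⟩, hu₂₃⟩, hrat⟩, hwalk⟩ := h
  simp only [rootOK, unitOK, Bool.and_eq_true, Bool.not_eq_true', decide_eq_true_eq,
    decide_eq_false_iff_not] at hk₁ hk₂ hk₃ hu₁₂ hu₁₃ hu₂₃
  have hf₁₂ : ¬ (q : ℤ) ∣ (splitPow q N (ε₁ - ε₂)).2 := fun hd => hu₁₂ (Int.emod_eq_zero_of_dvd hd)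
  have hf₁₃ : ¬ (q : ℤ) ∣ (splitPow q N (ε₁ - ε₃)).2 := fun hd => hu₁₃ (Int.emod_eq_zero_of_dvd hd)
  have hf₂₃ : ¬ (q : ℤ) ∣ (splitPow q N (ε₂ - ε₃)).2 := fun hd => hu₂₃ (Int.emod_eq_zero_of_dvd hd)
  -- the three root relations
  have rel : ∀ ε : ℤ, (ε ^ 3 + a * ε ^ 2 + b * ε + c) % ((q ^ N : ℕ) : ℤ) = 0 →
      (q : ℤ) ^ N ∣ (q : ℤ) ^ (rootData q N z t₁ t₂ ε).2.1 * (rootData q N z t₁ t₂ ε).2.2 *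
          (r₀ + r₁ * ε + r₂ * ε ^ 2) ^ 2 - ((zsq a b c z (r₀, r₁, r₂)).1 - n ^ 2 * (rootData q N z t₁ t₂ ε).1) := by
    intro ε hg
    have h1 := root_rel_mod hg h0
    have h2 := splitPow_spec q N ((z.1 + z.2.1 * ε + z.2.2 * ε ^ 2) % ((q ^ N : ℕ) : ℤ))
    simp only [rootData]
    rw [← h2]
    exact h1
  have rel₁ := rel ε₁ hk₁.1
  have rel₂ := rel ε₂ hk₂.1
  have rel₃ := rel ε₃ hk₃.1
  -- name the data
  generalize hw₀ : (zsq a b c z (r₀, r₁, r₂)).1 = w₀ at rel₁ rel₂ rel₃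
  generalize hD : (splitPow q N (ε₁ - ε₂)).1 + (splitPow q N (ε₁ - ε₃)).1 + (splitPow q N (ε₂ - ε₃)).1 = D
    at hwalk
  generalize hρ₁ : rootData q N z t₁ t₂ ε₁ = ρ₁ at hk₁ rel₁ hrat hwalk
  generalize hρ₂ : rootData q N z t₁ t₂ ε₂ = ρ₂ at hk₂ rel₂ hrat hwalk
  generalize hρ₃ : rootData q N z t₁ t₂ ε₃ = ρ₃ at hk₃ rel₃ hrat hwalk
  have hu₁ : ¬ (q : ℤ) ∣ ρ₁.2.2 := fun hd => hk₁.2 (Int.emod_eq_zero_of_dvd hd)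
  have hu₂ : ¬ (q : ℤ) ∣ ρ₂.2.2 := fun hd => hk₂.2 (Int.emod_eq_zero_of_dvd hd)
  have hu₃ : ¬ (q : ℤ) ∣ ρ₃.2.2 := fun hd => hk₃.2 (Int.emod_eq_zero_of_dvd hd)
  have hLu : ∀ ρ ∈ [ρ₁, ρ₂, ρ₃], ¬ (q : ℤ) ∣ ρ.2.2 := by
    intro ρ hρ
    simp only [List.mem_cons, List.not_mem_nil, or_false] at hρ
    rcases hρ with rfl | rfl | rfl
    · exact hu₁
    · exact hu₂
    · exact hu₃
  by_cases hn : (q : ℤ) ∣ n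
  · -- `q ∣ n`: a root with `q^(D+1) ∤ R` by the index lemma, then `caseB`
    have hex : ∃ ρ ∈ [ρ₁, ρ₂, ρ₃], ∃ R : ℤ, ¬ (q : ℤ) ^ (D + 1) ∣ R ∧
        (q : ℤ) ^ N ∣ (q : ℤ) ^ ρ.2.1 * ρ.2.2 * R ^ 2 - (w₀ - n ^ 2 * ρ.1) := by
      by_contra hall
      push Not at hall
      have d₁ : (q : ℤ) ^ (D + 1) ∣ r₀ + r₁ * ε₁ + r₂ * ε₁ ^ 2 := by
        by_contra hnd; exact hall ρ₁ (by simp) _ hnd rel₁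
      have d₂ : (q : ℤ) ^ (D + 1) ∣ r₀ + r₁ * ε₂ + r₂ * ε₂ ^ 2 := by
        by_contra hnd; exact hall ρ₂ (by simp) _ hnd rel₂
      have d₃ : (q : ℤ) ^ (D + 1) ∣ r₀ + r₁ * ε₃ + r₂ * ε₃ ^ 2 := by
        by_contra hnd; exact hall ρ₃ (by simp) _ hnd rel₃
      rw [← hD] at d₁ d₂ d₃
      have hidx := index_lemma hq (splitPow_spec q N (ε₁ - ε₂)) (splitPow_spec q N (ε₁ - ε₃))
        (splitPow_spec q N (ε₂ - ε₃)) hf₁₂ hf₁₃ hf₂₃ d₁ d₂ d₃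
      exact hprim ⟨hidx.1, hidx.2.1, hidx.2.2, hn⟩
    obtain ⟨ρ, hρ, R, hR, hrel⟩ := hex
    refine caseB hq hwalk ?_ (notRat_spec hrat) hρ hR hrel
    intro ρ hρ
    simp only [List.mem_cons, List.not_mem_nil, or_false] at hρ
    rcases hρ with rfl | rfl | rfl
    · exact ⟨hu₁, le_max_left _ _, _, rel₁⟩
    · exact ⟨hu₂, le_trans (le_max_left _ _) (le_max_right _ _), _, rel₂⟩
    · exact ⟨hu₃, le_trans (le_max_right _ _) (le_max_right _ _), _, rel₃⟩
  · -- `q ∤ n`: the walk at offset `0` with `y = w₀ / n²`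
    refine kill_of_walk hq (K := 0) (Nat.zero_le _) (by rfl) hwalk hLu (y₀ := w₀) hn ?_
    intro ρ hρ
    simp only [List.mem_cons, List.not_mem_nil, or_false] at hρ
    rcases hρ with rfl | rfl | rfl
    · exact ⟨r₀ + r₁ * ε₁ + r₂ * ε₁ ^ 2, by rw [pow_zero, one_mul]; exact rel₁⟩
    · exact ⟨r₀ + r₁ * ε₂ + r₂ * ε₂ ^ 2, by rw [pow_zero, one_mul]; exact rel₂⟩
    · exact ⟨r₀ + r₁ * ε₃ + r₂ * ε₃ ^ 2, by rw [pow_zero, one_mul]; exact rel₃⟩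

end Summit.BirchSwinnertonDyer.BirchSwinnertonDyer.Theorems.ShaPrimaryTransferSelmerCubicKill
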